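import Literature.NumberTheory.GaloisRepresentations.HeckeCharacterExtensionQuadratic
import Literature.NumberTheory.GaloisRepresentations.HeckeCharacterArchTypeProofs
import Literature.NumberTheory.GaloisRepresentations.HeckeCharacterAutConj
import Literature.NumberTheory.Automorphic.AdeleGaloisDescent
import HarnessLib

/-!
# Extension of idele class characters along a quadratic extension: Weil's extension principle,
# quadratic/CM bookkeeping, and the neighbourhood `𝕌_K ∩ W_𝔣`

Topic `NumberTheory/GaloisRepresentations`; namespace
`Literature.NumberTheory.GaloisRepresentations.HeckeCharacter` (and `….HeckeCharacter.CMQuadraticExtension`).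
Proof file (theorems only: no definition, no named fact, no instance), first of three
(`…WeilProofs`, `…ArchProofs`, `…CMProofs`) proving the CM / finite-order special case of the named fact
`HewittRoss_heckeCharacter_extension_quadratic` (`HeckeCharacterExtensionQuadratic.lean`) WITHOUT
Pontryagin duality, by Weil's method (A. Weil 1956, §1; the tree's engine
`HeckeCharacter.exists_isUnitary_infiniteIdeles_eq` of `HeckeCharacterArchTypeProofs`):

* §1 `HeckeCharacter.exists_extension_of_key` — **the extension principle**: given a unitary `χ₀` on
  `𝕀_{F₀}`, a subgroup `V ≤ 𝕀_K` which is a neighbourhood of `1`, and a unitary continuous character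
  `Φ` of `(K ⊗ ℝ)ˣ` such that `χ₀(a) Φ(y_∞) = 1` whenever `a_K y` (`y ∈ V`) is principal, there is a
  unitary Hecke character `χ` of `K` with `χ ∘ BC = χ₀` and `χ = Φ ∘ (·)_∞` on `V`.
* §2 `CMQuadraticExtension.*` — bookkeeping for a quadratic `K/F₀` with non-trivial automorphism `c`
  (`Aut(K/F₀) = {1, c}`, `c² = 1`, Galois descent for elements) and for the CM situation `F₀` totally real,
  `K` totally complex (`c` is complex conjugation under every embedding, fixes every infinite place, and
  `w ↦ w|_{F₀}` is injective).
* §3 the neighbourhood `V = 𝕌_K ∩ W_{𝔪(S,E)}` (tree `unitIdeles`, `congruenceIdeles`, `modulusIdeal`):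
  it is a neighbourhood of `1`, contains the local units off `S`, imposes `y_u ≡ 1 mod 𝔭_u^{E u}` on `S`,
  and — the finite-part compatibility `map_eq_one_of_baseChange_mem_nbhd` — a module of definition of
  `χ₀` whose places are all below `S` with large enough `E` makes `χ₀` kill the ideles `b` with `b_∞ = 1`,
  `b_K ∈ V`.

## References

* A. Weil, *On a certain type of characters of the idèle-class group of an algebraic number-field*,
  Proc. Int. Symp. Tokyo–Nikko 1955 (1956), 1–7, §1. [Weil1956]
* E. Hewitt, K. A. Ross, *Abstract Harmonic Analysis* I, Grundlehren 115 (1979), Thm. (24.12). [HewittRoss1979]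
* J. Neukirch, *Algebraic Number Theory*, Grundlehren 322 (1999), Ch. VI §1, Ch. VII §6. [NeukirchANT1999]
-/

noncomputable section

open scoped NumberField Topology
open NumberField IsDedekindDomain Filter
open Literature.NumberTheory.Automorphic

namespace Literature.NumberTheory.GaloisRepresentations

namespace HeckeCharacter

variable {F₀ K : Type} [Field F₀] [NumberField F₀] [Field K] [NumberField K] [Algebra F₀ K]

/-! ### §1. The extension principle (Weil): a character on `BC(𝕀_{F₀}) · V`, `V` a neighbourhood
of `1`, killing the principal ideles it meets, extends to a unitary Hecke character -/

/-- **Extension principle.**  Let `χ₀` be a unitary Hecke character of `F₀`, `V ≤ 𝕀_K` a subgroup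
which is a neighbourhood of `1`, and `Φ` a unitary continuous character of `(K ⊗ ℝ)ˣ`.  If
`χ₀(a) Φ(y_∞) = 1` whenever `a_K · y` (`a ∈ 𝕀_{F₀}`, `y ∈ V`) is a principal idele of `K`, then there
is a unitary Hecke character `χ` of `K` with `χ ∘ BC = χ₀` and `χ(y) = Φ(y_∞)` on `V`.  (The character
`a_K y ↦ χ₀(a) Φ(y_∞)` of the subgroup `BC(𝕀_{F₀}) V` is well defined and kills the principal ideles in
it, so it extends to `𝕀_K / Kˣ` with values in the divisible group `S¹`
(`Subgroup.exists_monoidHom_extension_eq_one`); it is continuous because it is so on the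
neighbourhood `V` of `1`.) [cite: Weil1956, §1] -/
theorem exists_extension_of_key (χ₀ : HeckeCharacter F₀) (hχ₀ : χ₀.IsUnitary)
    (V : Subgroup (ideleGroup K)) (hV : (V : Set (ideleGroup K)) ∈ 𝓝 (1 : ideleGroup K))
    (Φ : (InfiniteAdeleRing K)ˣ →ₜ* ℂˣ) (hΦ : ∀ z, ‖(Φ z : ℂ)‖ = 1)
    (hkey : ∀ (a : ideleGroup F₀) (y : ideleGroup K) (k : Kˣ), y ∈ V →
      AdeleRing.ideleBaseChange F₀ K a * y = principalIdele K k →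
      (χ₀ a : ℂ) * Φ (HeckeCharacter.infPart K y) = 1) :
    ∃ χ : HeckeCharacter K, χ.IsUnitary ∧ (∀ x, χ (AdeleRing.ideleBaseChange F₀ K x) = χ₀ x) ∧
      ∀ y ∈ V, (χ y : ℂ) = Φ (HeckeCharacter.infPart K y) := by
  classical
  set BC := AdeleRing.ideleBaseChange F₀ K with hBC
  -- the two characters with values in `S¹`
  let χ₀c : ideleGroup F₀ →* Circle :=
    { toFun := fun a => ⟨(χ₀ a : ℂ), mem_sphere_zero_iff_norm.mpr (hχ₀ a)⟩
      map_one' := Circle.ext (by simp)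
      map_mul' := fun a b => Circle.ext (by simp) }
  let Φc : (InfiniteAdeleRing K)ˣ →* Circle :=
    { toFun := fun z => ⟨(Φ z : ℂ), mem_sphere_zero_iff_norm.mpr (hΦ z)⟩
      map_one' := Circle.ext (by simp)
      map_mul' := fun a b => Circle.ext (by simp) }
  have hχ₀c : ∀ a, ((χ₀c a : Circle) : ℂ) = (χ₀ a : ℂ) := fun a => rfl
  have hΦc : ∀ z, ((Φc z : Circle) : ℂ) = (Φ z : ℂ) := fun z => rfl
  -- the product group `𝕀_{F₀} × V`, the multiplication map `Θ` and the character `θ`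
  let Θ : ideleGroup F₀ × V →* ideleGroup K := BC.coprod V.subtype
  let θ : ideleGroup F₀ × V →* Circle :=
    χ₀c.coprod (Φc.comp ((HeckeCharacter.infPart K).comp V.subtype))
  have hΘ : ∀ g : ideleGroup F₀ × V, Θ g = BC g.1 * (g.2 : ideleGroup K) := fun g => rfl
  have hθ : ∀ g : ideleGroup F₀ × V,
      ((θ g : Circle) : ℂ) = (χ₀ g.1 : ℂ) * Φ (HeckeCharacter.infPart K (g.2 : ideleGroup K)) := by
    intro g
    change (((χ₀c g.1 * Φc (HeckeCharacter.infPart K (g.2 : ideleGroup K)) : Circle) : ℂ)) = _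
    rw [Circle.coe_mul]
    rfl
  -- `θ` kills `Θ⁻¹(Kˣ)`
  have hθP : ∀ g : ideleGroup F₀ × V, Θ g ∈ principalIdeles K → θ g = 1 := by
    rintro ⟨a, y⟩ ⟨k, hk⟩
    apply Circle.ext
    rw [hθ, Circle.coe_one]
    exact hkey a y k y.2 hk.symm
  -- hence `θ` factors through `W = Θ(𝕀_{F₀} × V)`
  have hθwd : ∀ g g' : ideleGroup F₀ × V, Θ g = Θ g' → θ g = θ g' := by
    intro g g' h
    have h1 : Θ (g * g'⁻¹) ∈ principalIdeles K := by
      rw [map_mul, map_inv, h, mul_inv_cancel]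
      exact (principalIdeles K).one_mem
    have := hθP _ h1
    rwa [map_mul, map_inv, mul_inv_eq_one] at this
  set W : Subgroup (ideleGroup K) := Θ.range with hWdef
  have hWex : ∀ w : W, ∃ g, Θ g = (w : ideleGroup K) := fun w => w.2
  choose pre hpre using hWex
  let φ : W →* Circle :=
    { toFun := fun w => θ (pre w)
      map_one' := by
        rw [← map_one θ]
        exact hθwd _ _ (by rw [hpre, map_one]; rfl)
      map_mul' := fun w w' => by
        rw [← map_mul]
        exact hθwd _ _ (by rw [hpre, map_mul, hpre, hpre]; rfl) }
  have hφΘ : ∀ g, φ ⟨Θ g, ⟨g, rfl⟩⟩ = θ g := fun g => hθwd _ _ (hpre _)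
  have hφP : ∀ w : W, (w : ideleGroup K) ∈ principalIdeles K → φ w = 1 := by
    intro w hw
    change θ (pre w) = 1
    exact hθP _ (by rw [hpre]; exact hw)
  -- extend to `𝕀_K / Kˣ` with values in `S¹`
  obtain ⟨Ψ, hΨP, hΨW⟩ := Subgroup.exists_monoidHom_extension_eq_one Circle.exists_pow_eq
    (principalIdeles K) W φ hφP
  have hΨΘ : ∀ g, Ψ (Θ g) = θ g := fun g => by
    rw [show Θ g = ((⟨Θ g, ⟨g, rfl⟩⟩ : W) : ideleGroup K) from rfl, hΨW, hφΘ]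
  let ψ₀ : ideleGroup K →* ℂˣ := Circle.toUnits.comp Ψ
  have hψ₀V : ∀ y ∈ V, ψ₀ y = Φ (HeckeCharacter.infPart K y) := by
    intro y hy
    apply Units.ext
    have h := hΨΘ (1, ⟨y, hy⟩)
    change ((Ψ y : Circle) : ℂ) = _
    have e : Θ (1, ⟨y, hy⟩) = y := by rw [hΘ, map_one, one_mul]
    rw [e] at h
    rw [h, hθ, map_one, Units.val_one, one_mul]
  -- continuity: `ψ₀ = Φ ∘ (·)_∞` on the neighbourhood `V` of `1`
  have hcont : Continuous ψ₀ := by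
    refine continuous_of_continuousAt_one ψ₀ ?_
    have hc : Continuous fun x : ideleGroup K => Φ (HeckeCharacter.infPart K x) :=
      Φ.continuous.comp HeckeCharacter.continuous_infPart
    refine hc.continuousAt.congr ?_
    exact Filter.eventuallyEq_of_mem hV fun x hx => (hψ₀V x hx).symm
  let χ : HeckeCharacter K := ⟨⟨ψ₀, hcont⟩, fun x hx => by
    change Circle.toUnits (Ψ x) = 1
    rw [hΨP x hx, map_one]⟩
  have hχ : ∀ x, χ x = ψ₀ x := fun x => rfl
  refine ⟨χ, fun x => ?_, fun x => ?_, fun y hy => ?_⟩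
  · rw [hχ]
    exact Circle.norm_coe (Ψ x)
  · rw [hχ]
    apply Units.ext
    have h := hΨΘ (x, 1)
    have e : Θ (x, 1) = BC x := by rw [hΘ]; exact mul_one _
    rw [e] at h
    change ((Ψ (BC x) : Circle) : ℂ) = _
    rw [h, hθ]
    change (χ₀ x : ℂ) * Φ (HeckeCharacter.infPart K 1) = _
    rw [map_one, map_one, Units.val_one, mul_one]
  · rw [hχ, hψ₀V y hy]

/-! ### §2. Quadratic extensions with a distinguished involution; the CM situation -/

namespace CMQuadraticExtension

section Quadratic

variable (c : K ≃ₐ[F₀] K) (h2 : Module.finrank F₀ K = 2) (hc : c ≠ 1)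
include h2

/-- A quadratic extension of number fields is Galois. [folklore] -/
theorem isGalois : IsGalois F₀ K :=
  haveI : Algebra.IsQuadraticExtension F₀ K := ⟨h2⟩
  inferInstance

include hc

/-- The automorphisms of a quadratic extension with non-trivial automorphism `c` are `1` and `c`.
[folklore] -/
theorem algEquiv_eq_one_or_eq (σ : K ≃ₐ[F₀] K) : σ = 1 ∨ σ = c := by
  classical
  haveI := isGalois (F₀ := F₀) (K := K) h2
  haveI : FiniteDimensional F₀ K := Module.finite_of_finrank_eq_succ h2
  by_contra h
  rw [not_or] at h
  have hcard : Fintype.card (K ≃ₐ[F₀] K) = 2 := by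
    rw [← Nat.card_eq_fintype_card, IsGalois.card_aut_eq_finrank, h2]
  have h3 : ({1, c, σ} : Finset (K ≃ₐ[F₀] K)).card = 3 := by
    rw [Finset.card_insert_of_notMem, Finset.card_pair (Ne.symm h.2)]
    simp only [Finset.mem_insert, Finset.mem_singleton, not_or]
    exact ⟨fun h1 => hc h1.symm, fun h1 => h.1 h1.symm⟩
  have := Finset.card_le_univ ({1, c, σ} : Finset (K ≃ₐ[F₀] K))
  rw [h3, hcard] at this
  omega

/-- `c ∘ c = 1`. [folklore] -/
theorem mul_self_eq_one : c * c = 1 := by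
  rcases algEquiv_eq_one_or_eq c h2 hc (c * c) with h | h
  · exact h
  · exact absurd (mul_eq_left.mp h) hc

/-- `c (c x) = x`. [folklore] -/
theorem apply_apply (x : K) : c (c x) = x := by
  have := congrArg (fun σ : K ≃ₐ[F₀] K => σ x) (mul_self_eq_one c h2 hc)
  exact this

/-- `c⁻¹ = c`. [folklore] -/
theorem inv_eq_self : c⁻¹ = c :=
  inv_eq_of_mul_eq_one_right (mul_self_eq_one c h2 hc)

/-- **Galois descent for elements**: an element fixed by `c` comes from `F₀`. [folklore] -/
theorem exists_algebraMap_eq_of_apply_eq {k : K} (hk : c k = k) : ∃ k₀ : F₀, algebraMap F₀ K k₀ = k := by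
  haveI := isGalois (F₀ := F₀) (K := K) h2
  haveI : FiniteDimensional F₀ K := Module.finite_of_finrank_eq_succ h2
  refine (IsGalois.mem_range_algebraMap_iff_fixed k).mpr fun σ => ?_
  rcases algEquiv_eq_one_or_eq c h2 hc σ with rfl | rfl
  · rfl
  · exact hk

end Quadratic

section CM

variable (c : K ≃ₐ[F₀] K) (h2 : Module.finrank F₀ K = 2) (hc : c ≠ 1)
  (hTR : IsTotallyReal F₀) (hTC : IsTotallyComplex K)
include h2 hc hTR hTC

/-- **In the CM situation `c` is complex conjugation under every complex embedding**: for `F₀`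
totally real, `K` totally complex quadratic over `F₀` and `c ≠ 1`, every `φ : K → ℂ` satisfies
`φ ∘ c = conj ∘ φ`. [folklore] -/
theorem isConj (φ : K →+* ℂ) : ComplexEmbedding.IsConj φ c := by
  haveI := isGalois (F₀ := F₀) (K := K) h2
  haveI := hTC
  have hram : (InfinitePlace.mk φ).IsRamified F₀ := by
    rw [InfinitePlace.isRamified_iff]
    exact ⟨hTC.isComplex _, hTR.isReal _⟩
  obtain ⟨σ, hσ⟩ := InfinitePlace.exists_isConj_of_isRamified hram
  have hσ1 : σ ≠ 1 :=
    (ComplexEmbedding.isConj_ne_one_iff hσ).mpr (IsTotallyComplex.complexEmbedding_not_isReal φ)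
  rcases algEquiv_eq_one_or_eq c h2 hc σ with h1 | h1
  · exact absurd h1 hσ1
  · rwa [h1] at hσ

/-- `φ (c x) = conj (φ x)`. [folklore] -/
theorem apply_conj (φ : K →+* ℂ) (x : K) : φ (c x) = starRingEnd ℂ (φ x) :=
  (isConj c h2 hc hTR hTC φ).eq x

/-- Every infinite place of `K` is fixed by `c`. [folklore] -/
theorem smul_infinitePlace (w : InfinitePlace K) : c • w = w := by
  rw [← InfinitePlace.mk_embedding w, InfinitePlace.smul_mk]
  have : w.embedding.comp (c.symm : K →+* K) = ComplexEmbedding.conjugate w.embedding := by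
    ext x
    change w.embedding (c.symm x) = starRingEnd ℂ (w.embedding x)
    rw [show c.symm = c⁻¹ from rfl, inv_eq_self c h2 hc, apply_conj c h2 hc hTR hTC]
  rw [this, InfinitePlace.mk_conjugate_eq]

/-- `w (c x) = w x` for every infinite place `w` of `K`. [folklore] -/
theorem infinitePlace_apply_conj (w : InfinitePlace K) (x : K) : w (c x) = w x := by
  conv_rhs => rw [← smul_infinitePlace c h2 hc hTR hTC w, InfinitePlace.smul_apply]
  rw [show c.symm = c⁻¹ from rfl, inv_eq_self c h2 hc]

/-- Over each infinite place of `F₀` there is exactly one infinite place of `K`: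
`w ↦ w|_{F₀}` is injective. [folklore] -/
theorem comap_injective : Function.Injective
    (fun w : InfinitePlace K => w.comap (algebraMap F₀ K)) := by
  haveI := isGalois (F₀ := F₀) (K := K) h2
  intro w w' h
  obtain ⟨σ, rfl⟩ := InfinitePlace.exists_smul_eq_of_comap_eq h
  rcases algEquiv_eq_one_or_eq c h2 hc σ with h1 | h1
  · rw [h1]; exact (one_smul _ _).symm
  · rw [h1]; exact (smul_infinitePlace c h2 hc hTR hTC w).symm

end CM

end CMQuadraticExtension

/-! ### §3. The neighbourhood `V = 𝕌_K ∩ W_𝔣` and the finite-part compatibility with `χ₀` -/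

namespace CMQuadraticExtension

section Nbhd

variable (S : Finset (HeightOneSpectrum (𝓞 K))) (E : HeightOneSpectrum (𝓞 K) → ℕ)

/-- `V = 𝕌_K ∩ W_{𝔪(S,E)}` is a neighbourhood of `1` in `𝕀_K`. [folklore] -/
theorem nbhd_mem_nhds_one :
    ((unitIdeles K ⊓ congruenceIdeles (modulusIdeal S E) : Subgroup (ideleGroup K)) :
      Set (ideleGroup K)) ∈ 𝓝 (1 : ideleGroup K) := by
  rw [Subgroup.coe_inf]
  exact Filter.inter_mem ((isOpen_unitIdeles K).mem_nhds (unitIdeles K).one_mem)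
    (congruenceIdeles_mem_nhds_one (modulusIdeal_ne_bot S E))

/-- Local units at a place outside `S` lie in `V`. [folklore] -/
theorem localUnits_mem_nbhd {u : HeightOneSpectrum (𝓞 K)} (hu : u ∉ S)
    (ε : (u.adicCompletionIntegers K)ˣ) :
    localUnits u (Units.map ((u.adicCompletionIntegers K).subtype : _ →* _) ε) ∈
      (unitIdeles K ⊓ congruenceIdeles (modulusIdeal S E) : Subgroup (ideleGroup K)) := by
  refine ⟨fun w => ?_, localUnits_mem_congruenceIdeles (modulusIdeal_ne_bot S E)
    (fun h => hu (modulusIdeal_le_iff.mp h)) _⟩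
  by_cases hw : w = u
  · subst hw
    rw [localUnits_snd_apply_self]
    change Valued.v ((ε : w.adicCompletionIntegers K) : w.adicCompletion K) = 1
    apply le_antisymm (ε : w.adicCompletionIntegers K).2
    have h := (ε⁻¹ : (w.adicCompletionIntegers K)ˣ).1.2
    rw [HeightOneSpectrum.mem_adicCompletionIntegers] at h
    have hmul : ((ε : w.adicCompletionIntegers K) : w.adicCompletion K) *
        (((ε⁻¹ : (w.adicCompletionIntegers K)ˣ) : w.adicCompletionIntegers K) : w.adicCompletion K) = 1 := by
      rw [← Subring.coe_mul, ← Units.val_mul, mul_inv_cancel]; rfl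
    have hv := congrArg Valued.v hmul
    rw [map_mul, map_one] at hv
    calc (1 : WithZero (Multiplicative ℤ)) = Valued.v ((ε : w.adicCompletionIntegers K) : w.adicCompletion K) *
          Valued.v (((ε⁻¹ : (w.adicCompletionIntegers K)ˣ) : w.adicCompletionIntegers K) : w.adicCompletion K) := hv.symm
      _ ≤ Valued.v ((ε : w.adicCompletionIntegers K) : w.adicCompletion K) * 1 := mul_le_mul' le_rfl h
      _ = _ := mul_one _
  · rw [localUnits_snd_apply_of_ne _ hw, map_one]

/-- The congruence imposed by `V` at `u ∈ S`: `y_u ≡ 1 mod 𝔭_u^{E u}`. [folklore] -/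
theorem valued_sub_one_le_of_mem_nbhd {y : ideleGroup K}
    (hy : y ∈ (unitIdeles K ⊓ congruenceIdeles (modulusIdeal S E) : Subgroup (ideleGroup K)))
    {u : HeightOneSpectrum (𝓞 K)} (hu : u ∈ S) :
    Valued.v ((y : AdeleRing (𝓞 K) K).2 u - 1) ≤ WithZero.exp (-(E u : ℤ)) := by
  have hle : E u + 1 ≤ modulusExp (modulusIdeal S E) u := by
    rw [modulusExp, ← Associates.prime_pow_dvd_iff_le (Associates.mk_ne_zero.mpr (modulusIdeal_ne_bot S E))
      ((Associates.irreducible_mk).mpr u.irreducible), ← Associates.mk_pow, Associates.mk_le_mk_iff_dvd]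
    exact pow_dvd_modulusIdeal E hu
  have hne : modulusExp (modulusIdeal S E) u ≠ 0 := by omega
  refine (hy.2.1 u hne).trans ?_
  rw [WithZero.exp_le_exp]
  omega

end Nbhd

section Beta

variable (χ₀ : HeckeCharacter F₀) {T₀ : Finset (HeightOneSpectrum (𝓞 F₀))}
  {e₀ : HeightOneSpectrum (𝓞 F₀) → ℕ} (S : Finset (HeightOneSpectrum (𝓞 K)))
  (E : HeightOneSpectrum (𝓞 K) → ℕ)

/-- **Finite-part compatibility.**  If `(T₀, e₀)` is a module of definition of `χ₀`, every
`v ∈ T₀` has a place `u ∈ S` above it, and `E u ≥ e₀(v) e(u|v)` there, then `χ₀` kills every idele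
`a` of `F₀` with `a_∞ = 1` whose base change lies in `V = 𝕌_K ∩ W_{𝔪(S,E)}`. [folklore] -/
theorem map_eq_one_of_baseChange_mem_nbhd (hmod : IsModulus χ₀ T₀ e₀)
    (hS : ∀ v ∈ T₀, ∃ u ∈ S, u.under (𝓞 F₀) = v)
    (hE : ∀ u ∈ S, e₀ (u.under (𝓞 F₀)) * (u.under (𝓞 F₀)).asIdeal.ramificationIdx' u.asIdeal ≤ E u)
    (a : ideleGroup F₀) (ha1 : (a : AdeleRing (𝓞 F₀) F₀).1 = 1)
    (haV : AdeleRing.ideleBaseChange F₀ K a ∈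
      (unitIdeles K ⊓ congruenceIdeles (modulusIdeal S E) : Subgroup (ideleGroup K))) :
    χ₀ a = 1 := by
  -- components of the base change
  have hcomp : ∀ (u : HeightOneSpectrum (𝓞 K)) {v : HeightOneSpectrum (𝓞 F₀)} (hu : u.under (𝓞 F₀) = v),
      ((AdeleRing.ideleBaseChange F₀ K a : ideleGroup K) : AdeleRing (𝓞 K) K).2 u =
        @adicCompletionOfLiesOver (𝓞 F₀) F₀ K (𝓞 K) _ _ _ _ _ _ _ _ _ _ _ _ _ _ _ _ v u
          ⟨(congrArg HeightOneSpectrum.asIdeal hu).symm⟩ ((a : AdeleRing (𝓞 F₀) F₀).2 v) := by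
    intro u v hu
    haveI : u.asIdeal.LiesOver v.asIdeal := ⟨(congrArg HeightOneSpectrum.asIdeal hu).symm⟩
    rw [AdeleRing.coe_ideleBaseChange, AdeleRing.baseChange_snd, FiniteAdeleRing.baseChange_apply,
      adicCompletionOfUnder_eq F₀ u hu (fun p => (a : AdeleRing (𝓞 F₀) F₀).2 p)]
  refine hmod a ha1 (fun v => ?_) (fun v hv => ?_)
  · obtain ⟨u, hu⟩ := HeightOneSpectrum.under_surjective (A := 𝓞 F₀) (B := 𝓞 K) v
    replace hu : u.under (𝓞 F₀) = v := hu
    haveI : u.asIdeal.LiesOver v.asIdeal := ⟨(congrArg HeightOneSpectrum.asIdeal hu).symm⟩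
    have h := haV.1 u
    rw [hcomp u hu, valued_adicCompletionOfLiesOver] at h
    exact (pow_eq_one_iff.mp h).resolve_right
      (Ideal.IsDedekindDomain.ramificationIdx'_ne_zero_of_liesOver u.asIdeal v.ne_bot)
  · obtain ⟨u, huS, hu⟩ := hS v hv
    haveI : u.asIdeal.LiesOver v.asIdeal := ⟨(congrArg HeightOneSpectrum.asIdeal hu).symm⟩
    have h := valued_sub_one_le_of_mem_nbhd S E haV huS
    rw [hcomp u hu, ← map_one (adicCompletionOfLiesOver F₀ K v u), ← map_sub,
      valued_adicCompletionOfLiesOver] at h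
    set e := v.asIdeal.ramificationIdx' u.asIdeal with he
    have hepos : e ≠ 0 := Ideal.IsDedekindDomain.ramificationIdx'_ne_zero_of_liesOver u.asIdeal v.ne_bot
    have hEu := hE u huS
    rw [hu] at hEu
    have h' : Valued.v ((a : AdeleRing (𝓞 F₀) F₀).2 v - 1) ^ e ≤ WithZero.exp (-(e₀ v : ℤ)) ^ e := by
      refine h.trans ?_
      rw [← WithZero.exp_nsmul, WithZero.exp_le_exp, smul_neg, nsmul_eq_mul, neg_le_neg_iff]
      have h3 : e * e₀ v ≤ E u := by rw [mul_comm]; exact hEu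
      exact_mod_cast h3
    exact le_of_pow_le_pow_left₀ hepos zero_le h'

end Beta

end CMQuadraticExtension

end HeckeCharacter

end Literature.NumberTheory.GaloisRepresentations

end
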